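import Mathlib
import Summits.QuantumFields.YangMills.Theorems.RationalShortRootRigidityNoU3Algebra
import Summits.QuantumFields.YangMills.Theorems.RationalShortRootRigidityAlternationRadial
import Summits.QuantumFields.YangMills.Theorems.RationalShortRootRigidityAlternationLocal
import Summits.QuantumFields.YangMills.Theorems.RationalShortRootRigidityAlternationPeel

/-!
# `RationalShortRootRigidity` — Step 4 (`stub_alternation`) assembly, part VI: the simple-real-shell case

ASSEMBLY of Step 4 of the paper proof of crux `stmt-QuantumFields-23124` (`F4SubCurvatureDoor.RationalShortRootRigidity`,
LINE g15-A of planner ym-idea-3; birth skeleton HOME l15/RationalShortRootRigidity-birth.lean; plan HOME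
l15/STUB-PLAN-Alternation.md §1–§3 — the case «D₀ = c·∏(p² + μ_j), simple real shells» named there as `stub_alternation_simple`).

**Theorem** (`simple_shell_radial`).  In the shell picture `N₀ = Ψ(E)` (part II) with radial denominator `R(p²)`: if all complex
roots of `R` are real and simple, the budget `deg Ψ(E) ≤ 2 deg R + 2`, the `W(B₄)`- and half-reflection invariance of `Ψ(E)` and the
axis-Stieltjes structure of `E(X, q)/R(X)` on every fibre force `Ψ(E)` to be radial.

Proof.  The `k = deg R` roots `ρ₀ < ⋯ < ρ_{k−1}` (sorted with `Finset.orderEmbOfFin`) factor `R = lc·∏(X − ρᵢ)`, so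
`R′(ρⱼ) = lc·∏_{i≠j}(ρⱼ − ρᵢ)` has sign `sign(lc)·(−1)^{k−1−j}` (tree lemma `prod_erase_eq_sign_mul`, p662301); the local analysis
(part IV) gives `E(ρⱼ, q) = R′(ρⱼ)·r_J`, `r_J ≥ 0`, i.e. the SHELL SIGNS (ALT) for the nodes `μᵢ = −ρ_{k−1−i}`; the alternation
core (part I) kills the `q`-components of `E` of degree `≥ 5`, and the quartic bottleneck (part III) gives radiality.

Mathlib + tree lemmas; THEOREMS ONLY; no named facts; no `sorry`; default heartbeats.  Nothing about the crux 23124, the route's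
rung or the Yang–Mills mass gap is proved here.  Free-hands width seat `ym-line-sfw-p2-w4` g18, `--supports stmt-QuantumFields-23124`.
-/

set_option autoImplicit false

namespace Summit.QuantumFields.YangMills.Theorems.RationalShortRootRigidity.Alternation

open scoped BigOperators Polynomial ComplexConjugate

/-! ### 1. Small facts -/

/-- `totalDegree T(Σᵢ Xᵢ²) ≤ 2·deg T` for every real polynomial `T`. [folklore] -/
theorem totalDegree_aeval_sumSq_le (T : ℝ[X]) :
    (Polynomial.aeval (∑ j : Fin 4, (MvPolynomial.X j : MvPolynomial (Fin 4) ℝ) ^ 2) T).totalDegree ≤ 2 * T.natDegree := by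
  classical
  rw [Polynomial.aeval_eq_sum_range]
  refine le_trans (MvPolynomial.totalDegree_finsetSum _ _) (Finset.sup_le fun i hi => ?_)
  refine le_trans (MvPolynomial.totalDegree_smul_le _ _) ?_
  rw [(sumSq_pow_top i).1]
  have := Finset.mem_range.1 hi
  omega

/-- At a SIMPLE root the root multiplicity is `1`: if `R(ρ) = 0` and `R′(ρ) ≠ 0` then `(X − ρ)² ∤ R`. [folklore] -/
theorem rootMultiplicity_le_one_of_simple (R : ℝ[X]) (hR : R ≠ 0) (ρ : ℝ) (hρ' : R.derivative.eval ρ ≠ 0) :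
    R.rootMultiplicity ρ ≤ 1 := by
  by_contra h
  push Not at h
  have hdvd : (Polynomial.X - Polynomial.C ρ) ^ 2 ∣ R := (Polynomial.le_rootMultiplicity_iff hR).1 h
  obtain ⟨Q, hQ⟩ := hdvd
  apply hρ'
  rw [hQ, Polynomial.derivative_mul, Polynomial.derivative_pow, Polynomial.derivative_X_sub_C]
  simp

/-! ### 2. The simple-real-shell case -/

/-- **Simple real shells ⇒ radial** (plan §1–§3): if all complex roots of `R` are real and simple, the shell form `E` of a
`W(F₄)`-invariant numerator with the budget and the axis-Stieltjes structure over `R(p²)` gives a radial `Ψ(E)`. [folklore] -/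
theorem simple_shell_radial (E : MvPolynomial (Fin 4) ℝ) (R : ℝ[X]) (hR : R ≠ 0)
    (hreal : ∀ z : ℂ, Polynomial.aeval z R = 0 → z.im = 0)
    (hsimple : ∀ ρ : ℝ, R.eval ρ = 0 → R.derivative.eval ρ ≠ 0)
    (hdeg : (MvPolynomial.bind₁
      (fun i : Fin 4 => if i = 0 then ∑ j : Fin 4, (MvPolynomial.X j : MvPolynomial (Fin 4) ℝ) ^ 2
        else MvPolynomial.X i) E).totalDegree ≤ 2 * R.natDegree + 2)
    (hB4 : ∀ (σ : Equiv.Perm (Fin 4)) (ε : Fin 4 → ℝ), (∀ i, ε i = 1 ∨ ε i = -1) →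
      ∀ p : Fin 4 → ℝ, MvPolynomial.eval (fun i => ε i * p (σ i)) (MvPolynomial.bind₁
        (fun i : Fin 4 => if i = 0 then ∑ j : Fin 4, (MvPolynomial.X j : MvPolynomial (Fin 4) ℝ) ^ 2
          else MvPolynomial.X i) E) =
        MvPolynomial.eval p (MvPolynomial.bind₁
          (fun i : Fin 4 => if i = 0 then ∑ j : Fin 4, (MvPolynomial.X j : MvPolynomial (Fin 4) ℝ) ^ 2
            else MvPolynomial.X i) E))
    (hHalf : ∀ p : Fin 4 → ℝ, MvPolynomial.eval (fun i => p i - (∑ j, p j) / 2) (MvPolynomial.bind₁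
        (fun i : Fin 4 => if i = 0 then ∑ j : Fin 4, (MvPolynomial.X j : MvPolynomial (Fin 4) ℝ) ^ 2
          else MvPolynomial.X i) E) =
        MvPolynomial.eval p (MvPolynomial.bind₁
          (fun i : Fin 4 => if i = 0 then ∑ j : Fin 4, (MvPolynomial.X j : MvPolynomial (Fin 4) ℝ) ^ 2
            else MvPolynomial.X i) E))
    (hSt : ∀ q : Fin 3 → ℝ, q ≠ 0 → ∃ (k : ℕ) (ω r : Fin k → ℝ) (c : Polynomial ℝ),
      (∀ j, 0 < ω j) ∧ (∀ j, 0 ≤ r j) ∧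
      ∀ t : ℝ, MvPolynomial.eval (Fin.cons (t ^ 2 + ∑ i, q i ^ 2) q : Fin 4 → ℝ) E =
        R.eval (t ^ 2 + ∑ i, q i ^ 2) * (c.eval (t ^ 2) + ∑ j, r j / (t ^ 2 + ω j ^ 2))) :
    ∃ F : Polynomial ℝ, ∀ p : Fin 4 → ℝ, MvPolynomial.eval p (MvPolynomial.bind₁
      (fun i : Fin 4 => if i = 0 then ∑ j : Fin 4, (MvPolynomial.X j : MvPolynomial (Fin 4) ℝ) ^ 2
        else MvPolynomial.X i) E) = F.eval (∑ i, p i ^ 2) := by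
  classical
  -- the `k = deg R` simple real roots, increasingly ordered
  set k : ℕ := R.natDegree with hk
  have hcard : Multiset.card R.roots = k := card_roots_eq_natDegree_of_roots_real R hreal
  have hnodup : R.roots.Nodup := by
    rw [Multiset.nodup_iff_count_le_one]
    intro ρ
    rw [Polynomial.count_roots]
    by_cases hρ : R.eval ρ = 0
    · exact rootMultiplicity_le_one_of_simple R hR ρ (hsimple ρ hρ)
    · rw [Polynomial.rootMultiplicity_eq_zero hρ]
      exact zero_le_one
  set s : Finset ℝ := R.roots.toFinset with hs
  have hsval : s.val = R.roots := by
    rw [hs, Multiset.toFinset_val, hnodup.dedup]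
  have hscard : s.card = k := by
    rw [Finset.card_def, hsval, hcard]
  set ρf : Fin k → ℝ := fun i => s.orderEmbOfFin hscard i with hρf
  have hρmono : StrictMono ρf := fun i j hij => (s.orderEmbOfFin hscard).strictMono hij
  have hρroot : ∀ i, R.eval (ρf i) = 0 := by
    intro i
    have hmem : ρf i ∈ s := s.orderEmbOfFin_mem hscard i
    rw [hs, Multiset.mem_toFinset, Polynomial.mem_roots hR] at hmem
    exact hmem
  -- the factorisation `R = lc · ∏ (X − ρ_i)`
  have hfac : R = Polynomial.C R.leadingCoeff * ∏ i : Fin k, (Polynomial.X - Polynomial.C (ρf i)) := by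
    have hprod : (R.roots.map fun a => Polynomial.X - Polynomial.C a).prod =
        ∏ i : Fin k, (Polynomial.X - Polynomial.C (ρf i)) := by
      rw [← hsval, ← Finset.prod_eq_multiset_prod, ← Finset.prod_coe_sort]
      exact (Fintype.prod_equiv (s.orderIsoOfFin hscard).toEquiv _ _ fun i => rfl).symm
    rw [← hprod]
    exact (Polynomial.C_leadingCoeff_mul_prod_multiset_X_sub_C hcard).symm
  have hlc : R.leadingCoeff ≠ 0 := Polynomial.leadingCoeff_ne_zero.2 hR
  -- derivative at the shells
  have hderiv : ∀ j : Fin k, R.derivative.eval (ρf j) =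
      R.leadingCoeff * ∏ i ∈ Finset.univ.erase j, (ρf j - ρf i) := by
    intro j
    have hR' : R = (Polynomial.X - Polynomial.C (ρf j)) *
        (Polynomial.C R.leadingCoeff * ∏ i ∈ Finset.univ.erase j, (Polynomial.X - Polynomial.C (ρf i))) := by
      conv_lhs => rw [hfac, ← Finset.mul_prod_erase Finset.univ (fun i => Polynomial.X - Polynomial.C (ρf i))
        (Finset.mem_univ j)]
      ring
    rw [derivative_eval_root_of_mul (ρf j) _ R hR']
    simp only [Polynomial.eval_mul, Polynomial.eval_C, Polynomial.eval_prod, Polynomial.eval_sub, Polynomial.eval_X]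
  -- shell signs (ALT) from the local analysis
  have hALT : ∀ q : Fin 3 → ℝ, q ≠ 0 → ∀ i : Fin k,
      0 ≤ R.leadingCoeff * (-1) ^ (i : ℕ) *
        MvPolynomial.eval (Fin.cons (-(-(ρf (Fin.rev i)))) q : Fin 4 → ℝ) E := by
    intro q hq i
    obtain ⟨k', ω, r, c, hω, hr, hid⟩ := hSt q hq
    obtain ⟨-, hrealroot⟩ := local_analysis E R c q ω r hr hid
    obtain ⟨rJ, hrJ, hval⟩ := hrealroot (ρf (Fin.rev i)) (hρroot _)
    rw [neg_neg, hval, hderiv, prod_erase_eq_sign_mul ρf hρmono (Fin.rev i)]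
    have hpos := prod_erase_abs_pos ρf hρmono (Fin.rev i)
    have hexp : (k - 1 - ((Fin.rev i : Fin k) : ℕ)) = (i : ℕ) := by
      rw [Fin.val_rev]
      have := i.2
      omega
    rw [hexp]
    have hsq : ((-1 : ℝ) ^ (i : ℕ)) * ((-1 : ℝ) ^ (i : ℕ)) = 1 := by
      rw [← pow_add, ← two_mul, pow_mul]
      norm_num
    have : R.leadingCoeff * (-1) ^ (i : ℕ) *
        (R.leadingCoeff * ((-1) ^ (i : ℕ) * ∏ i_1 ∈ Finset.univ.erase (Fin.rev i), |ρf (Fin.rev i) - ρf i_1|) * rJ) =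
        R.leadingCoeff ^ 2 * (((-1 : ℝ) ^ (i : ℕ)) * ((-1 : ℝ) ^ (i : ℕ))) *
          (∏ i_1 ∈ Finset.univ.erase (Fin.rev i), |ρf (Fin.rev i) - ρf i_1|) * rJ := by ring
    rw [this, hsq, mul_one]
    have : 0 ≤ R.leadingCoeff ^ 2 := sq_nonneg _
    positivity
  -- budget in the shell picture
  have hbudget : ∀ m ∈ E.support, 2 * m 0 + ∑ i : Fin 3, m (Fin.succ i) ≤ 2 * k + 2 :=
    fun m hm => le_trans (weight_le_totalDegree_shell E m hm) hdeg
  -- alternation core + quartic bottleneck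
  have hE5 := qComponent_eq_zero_of_alternation k (fun i => -(ρf (Fin.rev i)))
    (fun i j hij => by
      simp only [neg_lt_neg_iff]
      exact hρmono (Fin.rev_lt_rev.2 hij))
    R.leadingCoeff hlc E hbudget hALT
  exact radial_of_qComponents_le_four E _ hE5 rfl hB4 hHalf

end Summit.QuantumFields.YangMills.Theorems.RationalShortRootRigidity.Alternation
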